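import Summits.ResolutionOfSingularities.ResolutionOfSingularities.Theorems.EquisingularLiftEquisingularLiftBlowupModelCones
import Summits.ResolutionOfSingularities.ResolutionOfSingularities.Theorems.EquisingularLiftEquisingularLiftNatHypLocPrincipalScheme
import Summits.ResolutionOfSingularities.ResolutionOfSingularities.Theorems.EquisingularLiftEquisingularLiftNatSaturatedLift
import Literature.AlgebraicGeometry.Resolution.BlowupsLocal
import Summits.ResolutionOfSingularities.ResolutionOfSingularities.Theorems.EquisingularLiftEquisingularLiftNatSpecimenSmoothHypersurfaces
import Summits.ResolutionOfSingularities.ResolutionOfSingularities.Theorems.EquisingularLiftEquisingularLiftBlowupModelThree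
import HarnessLib

/-!
# Crux `EquisingularLift` (stmt-ResolutionOfSingularities-15660), line `Sketch` (v10c): regular blow-up models are INTRINSIC —
# transport along `H ≅ H'`, and the cone instances of the open residual in the CRUX'S OWN BINDER SHAPE `(H, ι)`

[OURS · leafhand-res-equisingularlift-6 g2, 2026-08-31; cell `pub/decomp-res`] AI-produced, weaker than expert review; NOT a statement of any
manuscript; nothing here proves resolution of singularities in positive characteristic.  DEF-FREE helper, `--supports stmt-…-15660`; standard
axioms; ZERO named hypotheses.

The conclusion of the open residual `stub_blowupModel_ge_five` — «`∃ 𝔞 ≠ ⊥` on `H` all of whose blow-ups are regular» — does not mention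
the embedding `ι`; it is invariant under isomorphisms of `H` (`IsBlowup.comp_iso`, Mathlib `IdealSheafData.comap_comp / comap_id / comap_bot`).
Consequently the `PGL_{n+1}(k)`-transport that the route currency `ELNatAt` would need (lh6 g0 census (q1)) is, in THIS currency, free: an
abstract `(H, ι)` of the crux with `range ι = V₊(F)` for a prime form `F` is isomorphic to the reduced hypersurface `V₊(F)`
(✓ `LargeChar.exists_iso_subscheme_projIdealSheaf_form`, lh5; `(F)~ = 𝓘_{V₊(F)}` by ✓ `projIdealSheaf_eq_vanishingIdeal`), so every
coordinate specimen lands on the abstract `H`: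

* `blowupModel_of_iso` — **regular blow-up models transport along isomorphisms** (any schemes);
* `idealSheaf_eq_projIdealSheaf` — for a form `F` with `(F)` radical, the reduced ideal sheaf of `V₊(F)` (`SmoothHypersurface.idealSheaf F`,
  the structure carried by `hypersurface F`) IS `(F)~`;
* ★ `blowupModel_of_range_eq` — **for the crux's binders** (`ι : H ↪ ℙⁿ⁺¹_k` a closed immersion, `H` integral) **with `range ι = V₊(F)`, `F` a
  prime form: a regular blow-up model of the coordinate hypersurface `hypersurface F` gives one of `H`**;
* ★ `blowupModel_of_range_eq_cone`, ★ `blowupModel_of_range_eq_linCone` — hence **every `(H, ι)` of the crux whose image is a cone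
  `V₊(G(x₁, …, x_{m+2})) ⊆ ℙ^{m+2}_k`, resp. a cone `V₊(G(x_{ι ·})) ⊆ ℙⁿ⁺¹_k` with linear vertex `ℙʳ`, over a prime form `G` with regular
  idle-variable charts has a regular blow-up model — every field, every characteristic, every dimension** (✓ `blowupModel_cone` /
  ✓ `blowupModel_linCone`, i.e. seat res-D-pv-013's ✓ `ConeN.isRegular_of_isBlowup_comap` / ✓ `LinCone.isRegular_of_isBlowup_comap`).

REMAINING for all quadrics in the residual's currency (exact): (q2) char-free normal form — every prime quadratic form over `k̄` becomes, under
`GL_{n+2}(k̄)`, `rename ι G` with `G` a NONSINGULAR quadratic form in `m + 2 ≥ 3` variables (split off the singular radical; M–L, NOT in tree);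
(q1′) the scheme isomorphism `V₊(F) ≅ V₊(F ∘ A)` for `A ∈ GL` (✓ `linSubstMap` is the morphism; iso + compatibility with `V₊`: S–M); then
`blowupModel_of_range_eq` + ✓ `blowupModel_linCone` close the degree-2 slice in all characteristics.  Honest: no registered stub closed.

References: [Hartshorne1977, II Cor. 5.16, II Ex. 7.12]; [StacksProject, Tag 0804]; [GortzWedhorn2020, Def. 13.90].
-/

set_option linter.dupNamespace false -- mandated namespace `Summit.<Summit>.<Problem>` of this single-conjunct summit

noncomputable section

open CategoryTheory CategoryTheory.Limits AlgebraicGeometry TopologicalSpace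
open MvPolynomial HomogeneousLocalization
open Literature.AlgebraicGeometry.Resolution
open Literature.AlgebraicGeometry.Motives Literature.AlgebraicGeometry.Motives.SmoothHypersurface
open Literature.AlgebraicGeometry.Motives.ProjectiveSpace
open AlgebraicGeometry.Scheme.IdealSheafData
open Summit.ResolutionOfSingularities.ResolutionOfSingularities.Cruxes.EquisingularLiftNat.Sections

universe u

namespace Summit.ResolutionOfSingularities.ResolutionOfSingularities.Cruxes.EquisingularLift.StrataSplit

/-! ## Regular blow-up models transport along isomorphisms -/

/-- **Regular blow-up models are intrinsic**: if `H ≅ H'` and `H'` carries a non-zero ideal sheaf all of whose blow-ups are regular, so does `H`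
(pull the ideal sheaf back; a blow-up of `H` followed by the isomorphism is a blow-up of `H'`, `IsBlowup.comp_iso`). [cite: GortzWedhorn2020, Def. 13.90] -/
theorem blowupModel_of_iso {H H' : Scheme.{u}} (e : H ≅ H')
    (h : ∃ 𝔞' : H'.IdealSheafData, 𝔞' ≠ ⊥ ∧ ∀ (Z : Scheme.{u}) (π : Z ⟶ H'), IsBlowup π 𝔞' → Scheme.IsRegular Z) :
    ∃ 𝔞 : H.IdealSheafData, 𝔞 ≠ ⊥ ∧ ∀ (Z : Scheme.{u}) (π : Z ⟶ H), IsBlowup π 𝔞 → Scheme.IsRegular Z := by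
  obtain ⟨𝔞', h0, hreg⟩ := h
  have hback : (𝔞'.comap e.hom).comap e.inv = 𝔞' := by
    rw [← Scheme.IdealSheafData.comap_comp, e.inv_hom_id, Scheme.IdealSheafData.comap_id]
  refine ⟨𝔞'.comap e.hom, fun hbot => h0 ?_, fun Z π hπ => ?_⟩
  · rw [← hback, hbot, Scheme.IdealSheafData.comap_bot]
  · have h2 := hπ.comp_iso e
    rw [hback] at h2
    exact hreg Z _ h2

/-! ## The reduced hypersurface `V₊(F)` is `V((F)~)` for `(F)` radical -/

section Hypersurface

variable {k : Type} [Field k] {n : ℕ}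

/-- **`𝓘_{V₊(F)} = (F)~`** for a form `F` of degree `e` with `(F)` radical (e.g. `F` prime): the reduced induced ideal sheaf of the closed set
`V₊(F)` (`SmoothHypersurface.idealSheaf F`) is the ideal sheaf of the homogeneous ideal `(F)` (✓ `projIdealSheaf_eq_vanishingIdeal`).
[cite: Hartshorne1977, II Cor. 5.16] -/
theorem idealSheaf_eq_projIdealSheaf (F : MvPolynomial (Fin (n + 2)) k) {e : ℕ} (hF : F.IsHomogeneous e)
    (hrad : (Ideal.span {F}).IsRadical) :
    letI := MvPolynomial.gradedAlgebra (σ := Fin (n + 2)) (R := k)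
    SmoothHypersurface.idealSheaf F =
      projIdealSheaf (homogeneousSubmodule (Fin (n + 2)) k)
        ⟨Ideal.span (Set.range fun _ : Fin 1 => F),
          isHomogeneous_span_of_forall_mem _ (fun _ : Fin 1 => F) (fun _ => e)
            (fun _ => (mem_homogeneousSubmodule e F).2 hF)⟩ := by
  letI := MvPolynomial.gradedAlgebra (σ := Fin (n + 2)) (R := k)
  have hset : Set.range (fun _ : Fin 1 => F) = {F} := by
    ext G
    simp only [Set.mem_range, Set.mem_singleton_iff, exists_const]
    exact eq_comm
  symm
  refine SatLift.projIdealSheaf_eq_vanishingIdeal _ ?_ _ _ ?_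
  · change (Ideal.span (Set.range fun _ : Fin 1 => F)).IsRadical
    rw [hset]
    exact hrad
  · ext y
    simp only [ProjectiveSpectrum.mem_zeroLocus, Set.singleton_subset_iff, SetLike.mem_coe]
    change F ∈ y.asHomogeneousIdeal ↔ Ideal.span (Set.range fun _ : Fin 1 => F) ≤ y.asHomogeneousIdeal.toIdeal
    rw [hset, Ideal.span_singleton_le_iff_mem]
    rfl

/-- ★ **From the coordinate hypersurface to the crux's abstract `(H, ι)`**: `ι : H ↪ ℙⁿ⁺¹_k` a closed immersion, `H` integral, `F` a PRIME form
with `range ι = V₊(F)`; then `H ≅ hypersurface F` (✓ `LargeChar.exists_iso_subscheme_projIdealSheaf_form` + `idealSheaf_eq_projIdealSheaf`), so a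
regular blow-up model of `hypersurface F` gives one of `H` (`blowupModel_of_iso`). [cite: Hartshorne1977, II Cor. 5.16] -/
theorem blowupModel_of_range_eq {H : Scheme.{0}} (ι : H ⟶ (projectiveSpace (n + 1) k).left) [IsClosedImmersion ι] [IsIntegral H]
    (F : MvPolynomial (Fin (n + 2)) k) {e : ℕ} (hF : F.IsHomogeneous e) (hprime : Prime F)
    (hrange : letI := MvPolynomial.gradedAlgebra (σ := Fin (n + 2)) (R := k)
      Set.range ι = {x : Proj (homogeneousSubmodule (Fin (n + 2)) k) | F ∈ x.asHomogeneousIdeal})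
    (hBM : letI := MvPolynomial.gradedAlgebra (σ := Fin (n + 2)) (R := k)
      ∃ 𝔞' : (hypersurface F).left.IdealSheafData, 𝔞' ≠ ⊥ ∧
      ∀ (Z : Scheme.{0}) (π : Z ⟶ (hypersurface F).left), IsBlowup π 𝔞' → Scheme.IsRegular Z) :
    ∃ 𝔞 : H.IdealSheafData, 𝔞 ≠ ⊥ ∧ ∀ (Z : Scheme.{0}) (π : Z ⟶ H), IsBlowup π 𝔞 → Scheme.IsRegular Z := by
  letI := MvPolynomial.gradedAlgebra (σ := Fin (n + 2)) (R := k)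
  obtain ⟨φ, -⟩ := LargeChar.exists_iso_subscheme_projIdealSheaf_form ι (by omega) F hF hprime hrange
  have hrad : (Ideal.span {F}).IsRadical :=
    ((Ideal.span_singleton_prime hprime.ne_zero).mpr hprime).isRadical
  have hI := idealSheaf_eq_projIdealSheaf F hF hrad
  have e2 : (projIdealSheaf (homogeneousSubmodule (Fin (n + 2)) k)
        ⟨Ideal.span (Set.range fun _ : Fin 1 => F),
          isHomogeneous_span_of_forall_mem _ (fun _ : Fin 1 => F) (fun _ => e)
            (fun _ => (mem_homogeneousSubmodule e F).2 hF)⟩).subscheme ≅ (hypersurface F).left :=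
    eqToIso (by rw [← hI]; rfl)
  exact blowupModel_of_iso (φ ≪≫ e2) hBM

/-- ★ **The cone instances of the open residual, in the crux's binder shape — every field, every characteristic, every dimension**: for the
crux's `ι : H ↪ ℙ^{m+2}_k` (closed immersion, `H` integral) with `range ι = V₊(G(x₁, …, x_{m+2}))` for a prime form `G ∈ k[T₀, …, T_{m+1}]`
whose idle-variable charts `k[T]/(G|_{Tᵢ := 1})` are regular rings, `H` has a non-zero ideal sheaf all of whose blow-ups are regular
(`blowupModel_of_range_eq` + ✓ `blowupModel_cone`). [cite: Hartshorne1977, II Ex. 7.12] -/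
theorem blowupModel_of_range_eq_cone {m : ℕ} {H : Scheme.{0}} (ι : H ⟶ (projectiveSpace (m + 2) k).left) [IsClosedImmersion ι]
    [IsIntegral H] (G : MvPolynomial (Fin (m + 2)) k) {d : ℕ} (hG : G.IsHomogeneous d) (hGp : Prime G)
    (hreg : ∀ i : Fin (m + 2), IsRegularRing (MvPolynomial (Fin (m + 2)) k ⧸
      Ideal.span {aeval (Function.update (X : Fin (m + 2) → MvPolynomial (Fin (m + 2)) k) i 1) G}))
    (hrange : letI := MvPolynomial.gradedAlgebra (σ := Fin (m + 2 + 1)) (R := k)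
      Set.range ι = {x : Proj (homogeneousSubmodule (Fin (m + 2 + 1)) k) |
        (rename Fin.succ G : MvPolynomial (Fin (m + 2 + 1)) k) ∈ x.asHomogeneousIdeal}) :
    ∃ 𝔞 : H.IdealSheafData, 𝔞 ≠ ⊥ ∧ ∀ (Z : Scheme.{0}) (π : Z ⟶ H), IsBlowup π 𝔞 → Scheme.IsRegular Z :=
  letI := MvPolynomial.gradedAlgebra (σ := Fin (m + 2 + 1)) (R := k)
  blowupModel_of_range_eq ι (rename Fin.succ G) (ConeN.isHomogeneous_rename_succ k G hG) (ConeN.prime_rename_succ k G hGp) hrange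
    (blowupModel_cone k G hG hGp hreg)

/-- ★ **The LINEAR-vertex cone instances, in the crux's binder shape — every field, every characteristic**: for the crux's `ι_H : H ↪ ℙⁿ⁺¹_k`
with `range ι_H = V₊(G(x_{ι 0}, …, x_{ι (m+1)}))`, `G` a prime form with regular idle-variable charts, `ι`/`e` complementary injections (vertex
`L = V(x_a : a ∉ range e) ≅ ℙʳ`), `H` has a non-zero ideal sheaf all of whose blow-ups are regular (`blowupModel_of_range_eq` +
✓ `blowupModel_linCone`).  With (q2) + (q1′) of the module docstring this covers every integral quadric. [cite: Hartshorne1977, II Ex. 7.12] -/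
theorem blowupModel_of_range_eq_linCone {r m : ℕ} {H : Scheme.{0}} (ιH : H ⟶ (projectiveSpace (n + 1) k).left) [IsClosedImmersion ιH]
    [IsIntegral H] (ι : Fin (m + 2) → Fin (n + 2)) (hι : Function.Injective ι) (e : Fin (r + 1) → Fin (n + 2))
    (he : Function.Injective e) (hιe : ∀ l, ι l ∉ Set.range e) (heι : ∀ a, a ∉ Set.range e → a ∈ Set.range ι)
    (G : MvPolynomial (Fin (m + 2)) k) {d : ℕ} (hG : G.IsHomogeneous d) (hGp : Prime G)
    (hreg : ∀ i : Fin (m + 2), IsRegularRing (MvPolynomial (Fin (m + 2)) k ⧸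
      Ideal.span {aeval (Function.update (X : Fin (m + 2) → MvPolynomial (Fin (m + 2)) k) i 1) G}))
    (hrange : letI := MvPolynomial.gradedAlgebra (σ := Fin (n + 2)) (R := k)
      Set.range ιH = {x : Proj (homogeneousSubmodule (Fin (n + 2)) k) | rename ι G ∈ x.asHomogeneousIdeal}) :
    ∃ 𝔞 : H.IdealSheafData, 𝔞 ≠ ⊥ ∧ ∀ (Z : Scheme.{0}) (π : Z ⟶ H), IsBlowup π 𝔞 → Scheme.IsRegular Z :=
  letI := MvPolynomial.gradedAlgebra (σ := Fin (n + 2)) (R := k)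
  blowupModel_of_range_eq ιH (rename ι G) hG.rename_isHomogeneous (IdleVar.prime_rename ι hι hGp) hrange
    (blowupModel_linCone k ι hι e he hιe heι G hG hGp hreg)

end Hypersurface


/-! ## (append #1, leafhand-res-equisingularlift-6 g2) The regular case in the crux's binder shape: NONSINGULAR forms -/

section Nonsingular

variable {k : Type} [Field k] {n : ℕ}

/-- ★ **`(H, ι)` with `range ι = V₊(F)` for a NONSINGULAR prime form `F` of positive degree has a regular blow-up model (trivially: `H` is
regular)** — every field, every characteristic: `H ≅ hypersurface F` (✓ `LargeChar.exists_iso_subscheme_projIdealSheaf_form` +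
`idealSheaf_eq_projIdealSheaf`), ✓ `HypersurfaceSpecimen.isRegular_hypersurface_of_isNonsingularForm`, ✓ `exists_blowupModel_of_isRegular`.
Together with `blowupModel_of_range_eq_linCone` (vertex `ℙʳ`, `r ≥ 0`) this is the shape of every integral quadric after the normal form (q2).
[cite: Hartshorne1977, I Ex. 5.8] -/
theorem blowupModel_of_range_eq_of_isNonsingularForm {H : Scheme.{0}} (ι : H ⟶ (projectiveSpace (n + 1) k).left) [IsClosedImmersion ι]
    [IsIntegral H] (F : MvPolynomial (Fin (n + 2)) k) {e : ℕ} (hF : F.IsHomogeneous e) (he : 0 < e) (hprime : Prime F)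
    (hns : IsNonsingularForm k F)
    (hrange : letI := MvPolynomial.gradedAlgebra (σ := Fin (n + 2)) (R := k)
      Set.range ι = {x : Proj (homogeneousSubmodule (Fin (n + 2)) k) | F ∈ x.asHomogeneousIdeal}) :
    ∃ 𝔞 : H.IdealSheafData, 𝔞 ≠ ⊥ ∧ ∀ (Z : Scheme.{0}) (π : Z ⟶ H), IsBlowup π 𝔞 → Scheme.IsRegular Z := by
  letI := MvPolynomial.gradedAlgebra (σ := Fin (n + 2)) (R := k)
  obtain ⟨φ, -⟩ := LargeChar.exists_iso_subscheme_projIdealSheaf_form ι (by omega) F hF hprime hrange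
  have hrad : (Ideal.span {F}).IsRadical :=
    ((Ideal.span_singleton_prime hprime.ne_zero).mpr hprime).isRadical
  have hI := idealSheaf_eq_projIdealSheaf F hF hrad
  have e2 : (projIdealSheaf (homogeneousSubmodule (Fin (n + 2)) k)
        ⟨Ideal.span (Set.range fun _ : Fin 1 => F),
          isHomogeneous_span_of_forall_mem _ (fun _ : Fin 1 => F) (fun _ => e)
            (fun _ => (mem_homogeneousSubmodule e F).2 hF)⟩).subscheme ≅ (hypersurface F).left :=
    eqToIso (by rw [← hI]; rfl)
  have hreg : Scheme.IsRegular H :=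
    Scheme.IsRegular.of_iso (φ ≪≫ e2).inv (HypersurfaceSpecimen.isRegular_hypersurface_of_isNonsingularForm k F hF hns he)
  exact exists_blowupModel_of_isRegular hreg

end Nonsingular
end Summit.ResolutionOfSingularities.ResolutionOfSingularities.Cruxes.EquisingularLift.StrataSplit

end
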